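import Summits.QuantumFields.BalabanUV.Beta.GAN24.SubAveragingDirichlet

/-!
# `BalabanUV.Beta.GAN24.SubAveragingSplitting` — binder row G-an2-4 ∕ (CONV-C), programme «SUBAVG-RATE»
# (ROUTES-GAN24 R2-S1∕S2 ∘ R3-S3 executed at `U = 1` in the fibre∕strip currency), FILE 1b:
# THE EXACT SPLITTING OF THE LEVEL-`n·L` ONE-COORDINATE FACTORS INTO LEVEL-`n` FACTORS × SUB-BLOCK SUMS

NOT IN PRINT; OUR PROOF ATTEMPT (prover part P3 of row G-an2-4, fibre∕strip lineage, gen 22; CRUX TEAM (2) of the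
coordinator ruling «YM REDIRECT TOWARDS THE SUMMIT», 2026-08-21).  HONEST DEPENDENCY (cell records, verbatim):
«continuum YM on T⁴ ⇐ BetaPertH ∧ nine spine estimates (0/9 proved); BetaPertH ⇐ (D1) ∧ (D4) ∧ CAP+tail; G-an2-4 gates
asym, D1 and NE2/3/4.»  HONEST FRAMING (cell contract, verbatim): «discharging `BetaPertH` makes Bałaban's UV stability
UNCONDITIONAL — a real constructive-QFT result; it is NOT the continuum limit and NOT the Clay problem.»  ABSOLUTE RULE (cell
charter): nothing printed is used as a hypothesis; [folklore] algebra of geometric sums over the one-coordinate factors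
`w`, `v`, `ef` of `Literature.….B4StripSums` (the continued block-averaging factor `u(p′+l)` and the fine phase `e^{i(p′+l)x}`
of B4 (2.48), vendored there with their citation tags) and the sub-block weight `sw` of the sibling `SubAveragingDirichlet`.

## What is proved (every `n, L ≥ 1`, every alias index `K : ℕ`, all `z : ℂ` — identities of ENTIRE functions, no side condition)

* `gp`, `gm` := `L⁻¹ Σ_{ρ<L} e^{±i(z+2πK)ρ∕(nL)}`; `gp_eq`, `gm_eq` (`= L⁻¹ e^{±i(L−1)θ} D_L(θ)`, `θ = ang n L (z+2πK)`),
  **`gp_mul_gm`** (`gp · gm = sw n L K z`).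
* `sum_range_mul_pow` (a geometric sum over `range (n·L)` = the sum of `L`-th powers over `range n` × the sub-sum over
  `range L`), `w_mul_pow` (`(w (n·L) K z)^L = w n K z`), `w_add_mul` ∕ `v_add_mul` ∕ `ef_add_mul` (level-`n` factors do not
  see multiples of `n` in the alias index).
* **`v_mul`**: `v (n·L) K z = gm n L K z · v n K z` — composition of block averagings (B5 (1.17)) in one coordinate, alias by
  alias; **`ef_mul`**: `ef (n·L) K (L t + ρ) z = ef n K t z · e^{i(z+2πK)ρ∕(nL)}`; and the assembled
  **`subavg_numerator`**: `L⁻¹ Σ_{ρ<L} ef (n·L) K (Lt+ρ) z · v (n·L) K z = ef n K t z · v n K z · sw n L K z` — «the sub-cell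
  average of the finer numerator `e^{i(p′+l)x}u(p′+l)` is the coarse numerator times the sub-block weight».

NOT HERE: alias sums ∕ `E` ∕ kernels (siblings `SubAveragingCore`, `SubAveragingFibre`, `SubAveragingKernel`).  0∕4 row-D1
binders touched; NEVER «G-an2-4 closed»; NOT D1, NOT BetaPertH, NOT continuum, NOT Clay.  Provenance:
prover-b2b-balaban-gan24-p3-g22-0 (unit `b2b-balaban-gan24-p3`, gen 22), 2026-08-21.
-/

noncomputable section

namespace Summit.QuantumFields.BalabanUV.Beta.GAN24.SubAveragingSplitting

open Complex Finset
open Literature.MathematicalPhysics.QuantumFieldTheory.Balaban1983to89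
open Literature.MathematicalPhysics.QuantumFieldTheory.Balaban1983to89.B4Strip
open Literature.MathematicalPhysics.QuantumFieldTheory.Balaban1983to89.B4StripCauchy
open Literature.MathematicalPhysics.QuantumFieldTheory.Balaban1983to89.B4StripSums
open Summit.QuantumFields.BalabanUV.Beta.GAN24.SubAveragingDirichlet
open scoped Real

/-! ## §1 The geometric sub-sums `gp`, `gm` and `gp · gm = sw` -/

/-- [folklore] `gp n L K z = L⁻¹ Σ_{ρ<L} e^{i(z+2πK)ρ∕(nL)}` (the sub-cell average of the fine phase). -/
def gp (n L : ℕ) (K : ℕ) (z : ℂ) : ℂ := (L : ℂ)⁻¹ * ∑ ρ ∈ Finset.range L, cexp (I * (z + 2 * π * K) * ρ / (n * L))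

/-- [folklore] `gm n L K z = L⁻¹ Σ_{s<L} e^{−i(z+2πK)s∕(nL)}` (the sub-block part of the block-averaging factor). -/
def gm (n L : ℕ) (K : ℕ) (z : ℂ) : ℂ := (L : ℂ)⁻¹ * ∑ s ∈ Finset.range L, cexp (-(I * (z + 2 * π * K) * s / (n * L)))

/-- [folklore] `gp = L⁻¹ e^{i(L−1)θ} D_L(θ)`, `θ = ang n L (z+2πK)`. -/
theorem gp_eq (n L : ℕ) (hn : 1 ≤ n) (hL : 1 ≤ L) (K : ℕ) (z : ℂ) :
    gp n L K z = (L : ℂ)⁻¹ * (cexp (I * ((L - 1) * ang n L (z + 2 * π * K))) * dir L (ang n L (z + 2 * π * K))) := by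
  unfold gp dir
  congr 1
  rw [Finset.mul_sum]
  refine Finset.sum_congr rfl fun ρ _ => ?_
  rw [← Complex.exp_add]
  congr 1
  unfold ang
  have hL' : (L : ℂ) ≠ 0 := Nat.cast_ne_zero.mpr (by omega)
  have hn' : (n : ℂ) ≠ 0 := Nat.cast_ne_zero.mpr (by omega)
  field_simp
  ring

/-- [folklore] `gm = L⁻¹ e^{−i(L−1)θ} D_L(θ)` (via `dir_neg`). -/
theorem gm_eq (n L : ℕ) (hn : 1 ≤ n) (hL : 1 ≤ L) (K : ℕ) (z : ℂ) :
    gm n L K z = (L : ℂ)⁻¹ * (cexp (-(I * ((L - 1) * ang n L (z + 2 * π * K)))) * dir L (ang n L (z + 2 * π * K))) := by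
  rw [← dir_neg]
  unfold gm dir
  congr 1
  rw [Finset.mul_sum]
  refine Finset.sum_congr rfl fun ρ _ => ?_
  rw [← Complex.exp_add]
  congr 1
  unfold ang
  have hL' : (L : ℂ) ≠ 0 := Nat.cast_ne_zero.mpr (by omega)
  have hn' : (n : ℂ) ≠ 0 := Nat.cast_ne_zero.mpr (by omega)
  field_simp
  ring

/-- [folklore] **`gp · gm = sw`**: the product of the two sub-sums is the (entire) sub-block weight. -/
theorem gp_mul_gm (n L : ℕ) (hn : 1 ≤ n) (hL : 1 ≤ L) (K : ℕ) (z : ℂ) : gp n L K z * gm n L K z = sw n L K z := by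
  rw [gp_eq n L hn hL, gm_eq n L hn hL, sw]
  have hL' : (L : ℂ) ≠ 0 := Nat.cast_ne_zero.mpr (by omega)
  rw [Complex.exp_neg]
  have hE : cexp (I * ((↑L - 1) * ang n L (z + 2 * ↑π * ↑K))) ≠ 0 := Complex.exp_ne_zero _
  field_simp

/-- [folklore] a geometric sum over `range (n·L)` splits into the sub-sum over `range L` times the sum of `L`-th powers over
`range n`. -/
theorem sum_range_mul_pow (ω : ℂ) (n L : ℕ) :
    ∑ s ∈ Finset.range (n * L), ω ^ s = (∑ a ∈ Finset.range n, (ω ^ L) ^ a) * ∑ b ∈ Finset.range L, ω ^ b := by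
  induction n with
  | zero => simp
  | succ n ih =>
      have h2 : ∑ b ∈ Finset.range L, ω ^ (n * L + b) = (ω ^ L) ^ n * ∑ b ∈ Finset.range L, ω ^ b := by
        rw [Finset.mul_sum]
        refine Finset.sum_congr rfl fun b _ => ?_
        rw [← pow_mul, ← pow_add, mul_comm L n]
      rw [Nat.succ_mul, ← Finset.sum_range_add_sum_Ico (fun s => ω ^ s) (Nat.le_add_right (n * L) L), ih,
        Finset.sum_range_succ, add_mul, Finset.sum_Ico_eq_sum_range, Nat.add_sub_cancel_left, h2]

/-- [folklore] the level-`n` block-averaging factor does not see multiples of `n` in the alias index: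
`w n (k + n·m) z = w n k z`, hence `v n (k + n·m) z = v n k z`. -/
theorem w_add_mul (n : ℕ) (hn : 1 ≤ n) (k m : ℕ) (z : ℂ) : w n (k + n * m) z = w n k z := by
  unfold w
  have hn' : (n : ℂ) ≠ 0 := Nat.cast_ne_zero.mpr (by omega)
  have e : -(I * (z + 2 * ↑π * ↑(k + n * m)) / ↑n) = -(I * (z + 2 * ↑π * ↑k) / ↑n) + ((-(m : ℤ) : ℤ) : ℂ) * (2 * π * I) := by
    push_cast; field_simp; ring
  rw [e, Complex.exp_add, Complex.exp_int_mul_two_pi_mul_I, mul_one]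

/-- [folklore] `v n (k + n·m) z = v n k z`. -/
theorem v_add_mul (n : ℕ) (hn : 1 ≤ n) (k m : ℕ) (z : ℂ) : v n (k + n * m) z = v n k z := by
  unfold v; simp_rw [w_add_mul n hn k m z]

/-- [folklore] the fine phase does not see multiples of `n` in the alias index: `ef n (k + n·m) t z = ef n k t z`. -/
theorem ef_add_mul (n : ℕ) (hn : 1 ≤ n) (k m t : ℕ) (z : ℂ) : ef n (k + n * m) t z = ef n k t z := by
  unfold ef
  have hn' : (n : ℂ) ≠ 0 := Nat.cast_ne_zero.mpr (by omega)
  have e : I * (z + 2 * ↑π * ↑(k + n * m)) * ↑t / ↑n = I * (z + 2 * ↑π * ↑k) * ↑t / ↑n + ((m * t : ℕ) : ℂ) * (2 * π * I) := by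
    push_cast; field_simp; ring
  rw [e, Complex.exp_add, Complex.exp_nat_mul_two_pi_mul_I, mul_one]

/-- [folklore] the `L`-th power of the level-`n·L` root is the level-`n` root: `(w (n·L) K z)^L = w n K z`. -/
theorem w_mul_pow (n L : ℕ) (hL : 1 ≤ L) (K : ℕ) (z : ℂ) : w (n * L) K z ^ L = w n K z := by
  unfold w
  rw [← Complex.exp_nat_mul]
  congr 1
  have hL' : (L : ℂ) ≠ 0 := Nat.cast_ne_zero.mpr (by omega)
  push_cast
  field_simp

/-- [folklore] **SPLITTING OF THE BLOCK-AVERAGING FACTOR**: `v (n·L) K z = gm n L K z · v n K z` — the level-`n·L` block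
average of the alias `K` is the sub-block (`L`) average times the level-`n` block average (composition of averagings, B5 (1.17),
in one coordinate, as an identity of entire functions). -/
theorem v_mul (n L : ℕ) (hn : 1 ≤ n) (hL : 1 ≤ L) (K : ℕ) (z : ℂ) : v (n * L) K z = gm n L K z * v n K z := by
  have hL' : (L : ℂ) ≠ 0 := Nat.cast_ne_zero.mpr (by omega)
  have hn' : (n : ℂ) ≠ 0 := Nat.cast_ne_zero.mpr (by omega)
  unfold v gm
  rw [sum_range_mul_pow, w_mul_pow n L hL]
  have e : ∑ b ∈ Finset.range L, w (n * L) K z ^ b = ∑ s ∈ Finset.range L, cexp (-(I * (z + 2 * π * K) * s / (n * L))) := by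
    refine Finset.sum_congr rfl fun b _ => ?_
    unfold w
    rw [← Complex.exp_nat_mul]
    congr 1
    push_cast
    ring
  rw [e]
  push_cast
  field_simp

/-- [folklore] **SPLITTING OF THE FINE PHASE**: at the fine site `L·t + ρ` of the level-`n·L` lattice (sub-cell `ρ` of the
coarse fine site `t`), `ef (n·L) K (L t + ρ) z = ef n K t z · e^{i(z+2πK)ρ∕(nL)}`. -/
theorem ef_mul (n L : ℕ) (hn : 1 ≤ n) (hL : 1 ≤ L) (K t ρ : ℕ) (z : ℂ) :
    ef (n * L) K (L * t + ρ) z = ef n K t z * cexp (I * (z + 2 * π * K) * ρ / (n * L)) := by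
  have hL' : (L : ℂ) ≠ 0 := Nat.cast_ne_zero.mpr (by omega)
  have hn' : (n : ℂ) ≠ 0 := Nat.cast_ne_zero.mpr (by omega)
  unfold ef
  rw [← Complex.exp_add]
  congr 1
  push_cast
  field_simp

/-- [folklore] **THE SUB-CELL AVERAGE OF THE FINER ONE-COORDINATE NUMERATOR**: `L⁻¹ Σ_{ρ<L} ef (n·L) K (Lt+ρ) z · v (n·L) K z
= ef n K t z · v n K z · sw n L K z` — averaging the finer kernel's numerator `e^{i(p+l)x} u(p+l)` over the `L` sub-sites of a
coarse fine site gives the coarse numerator times the sub-block weight. -/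
theorem subavg_numerator (n L : ℕ) (hn : 1 ≤ n) (hL : 1 ≤ L) (K t : ℕ) (z : ℂ) :
    (L : ℂ)⁻¹ * ∑ ρ ∈ Finset.range L, ef (n * L) K (L * t + ρ) z * v (n * L) K z
      = ef n K t z * v n K z * sw n L K z := by
  simp_rw [ef_mul n L hn hL K t _ z, v_mul n L hn hL K z]
  rw [← gp_mul_gm n L hn hL K z, gp]
  have e : ∑ ρ ∈ Finset.range L, ef n K t z * cexp (I * (z + 2 * ↑π * ↑K) * ↑ρ / (↑n * ↑L)) * (gm n L K z * v n K z)
      = (ef n K t z * (gm n L K z * v n K z)) * ∑ ρ ∈ Finset.range L, cexp (I * (z + 2 * ↑π * ↑K) * ↑ρ / (↑n * ↑L)) := by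
    rw [Finset.mul_sum]
    exact Finset.sum_congr rfl fun ρ _ => by ring
  rw [e]
  ring

end Summit.QuantumFields.BalabanUV.Beta.GAN24.SubAveragingSplitting
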